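import Summits.Schanuel.Schanuel.Theorems.RootDecomp1BTwoStorey06

/-!
# RootDecomp1BTwoStorey — lens 4, generation 43 «TWO-PARAMETER RADICAL DESCENT: STOREY THREE AT (1, ρ, σ)» (lane B-R26 (e); CLAIM L2197, ACK/CHECKLIST B-g43 L2199, NODE L2206 / REQUEST L2207, writer re-check L2211, critic VERDICT L2210: CLEARED — ONE CELL (lane (e) «m = 3 storeys»; engine VARIANT-REACH+ of g30, class NEW-LOCAL, territory NEW); RULE B-R29; lens-4 tally THEOREM ×7 + CELL ×4) — continuation (RootDecomp1BTwoStorey07): §E the storey-three cells at (1, ρ, σ), (ρ, σ) ∈ JU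

(lens-4 g43 HOME kernel K = HOME/decomp-schanuel-lens-4/g43/TwoStorey.lean 24f29895…, 1683 l; VERDICT L2210 PORT GO; port by census-1 gen 19 as `RootDecomp1BTwoStorey01`–`06`: 01 = §A formal algebra + §B sizes; 02 = §D-data + §C part 1 (classes `UltraLiouville₂` / `JU`); 03 = §C part 2 (collision, two-dimensional non-vanishing, typed obstruction); 04 = §C part 3 (Baire density, controls); 05 = §D part 1: the CLASH ENGINE `radical₂_clash` (steps (2)–(5) of the g43 kernel proof stated on their own — census CAP EDITION, HAND-BACK L2252 / critic CONCUR L2253 under RESHAPE RULE L1684: the kernel `algebraicIndependent_radical₂` was ONE 459-line declaration > the 400-line file cap); 06 = §D part 2: THE KERNEL `algebraicIndependent_radical₂` (statement BYTE-IDENTICAL to K; proof = K's steps (0)–(1) verbatim + `exact radical₂_clash …`); 07 = §E storey-three cells.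
PORT EDITS: class defs' docstrings tagged; private port copies of length lemmas kept private; §D re-cut for the cap (one new public lemma `radical₂_clash`, proof text moved verbatim modulo the abstraction of the eigenvalue as `Φ` with `‖Φ‖ ≤ q^J·Kl·dJ`; nine now-unused local `have`s of the kernel dropped); every other statement and proof verbatim. `--supports stmt-Schanuel-24622`; no census credit carried; rung 0 — nothing here proves Schanuel.)
-/

noncomputable section

open Complex

namespace Summit.Schanuel.Schanuel.Theorems.RootDecomp1BTwoStorey

open Summit.Schanuel.Schanuel.Theorems.RootDecomp1BRadicalDescent (resFin resFin_val powSubst powSubst_X_self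
  powSubst_eq_zero_iff QDiv qdiv_powSubst residue_lemma)

/-! ## §E  THE CELLS — storey three at `r = (1, ρ, σ)`, `(ρ, σ) ∈ JU` (hypothesis-free: LW by `lwMeasure_holds`)

Base `y = (1, i)` (coordinatewise algebraic, `ℚ`-free), `θ = (e, e^{i})`, `i₀ = 0`, `y₀ = 1`: the kernel
`algebraicIndependent_radical₂` gives `(e^{ρ}, e^{σ}, ρ, σ, e, e^{i})` algebraically independent for every pair
`(ρ, σ) ∈ JU`; all six numbers lie in the polar field `F(1, ρ, σ) = ℚ(1, ρ, σ, i, iρ, iσ, e, e^{ρ}, e^{σ}, e^{i},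
e^{iρ}, e^{iσ})`, hence `t(1, ρ, σ) = polarDeg (1, ρ, σ) ≥ 6 = m + m` (`m = 3`): the Klein-polar Schanuel
inequality AT the `ℚ`-free triple `(1, ρ, σ)` — a STOREY-THREE cell — and with it the `m = 2 → 3` step instances
`(1, ρ | σ)` of the open analytic items of route 1B. The storeys below, `(1, ρ)` and `(1, σ)`, are g30 storey-two
cells BY NAME (`four_le_polarDeg_one_ultra`), since each coordinate of a `JU` pair is ultra-Liouville. -/

section Cells

open Summit.Schanuel.Schanuel.Theorems.RootDecomp1KHyper (LWMeasure)
open Summit.Schanuel.Schanuel.Theorems.RootDecomp1BFedFlagCore (KleinIH polarDeg polarField coe_mem_polarField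
  exp_coe_mem_polarField exp_coe_mul_I_mem_polarField coe_mul_I_mem_polarField)
open Summit.Schanuel.Schanuel.Theorems.RootDecomp1BTameFlagCore (IsWild LastTame HasSharpHyperplane)
open Summit.Schanuel.Schanuel.Theorems.RootDecomp1BDefectFloorDefs (SharpRelativeLindemannAt TameDefectZeroAt
  WildSharpDefectZeroAt WildSharpDefectZeroInitAt WildSharpInitAt)
open Summit.Schanuel.Schanuel.Theorems.RootDecomp1BDefectFloorCells (natCast_le_trdeg_of_algebraicIndependent)
open Summit.Schanuel.Schanuel.Theorems.RootDecomp1BRadicalDescent (UltraLiouville DExpMeasure dExpMeasure_exp_of_LW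
  isAlgebraic_base linearIndependent_base four_le_polarDeg_one_ultra kleinPolarSchanuel_body_two_one_ultra)
open Summit.Schanuel.Schanuel.Theorems.RootDecomp1BFactDischarge (lwMeasure_holds)

/-- `JU` from its four components (trivial constructor, for the record). -/
theorem JU_of {ρ σ : ℝ} (hρ0 : 0 < ρ) (hσ0 : 0 < σ) (h : UltraLiouville₂ ρ σ)
    (hai : AlgebraicIndependent ℚ ![(ρ : ℂ), (σ : ℂ)]) : JU ρ σ :=
  ⟨hρ0, hσ0, h, hai⟩

/-- `(1, ρ, σ)` is `ℚ`-free on `JU`. -/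
theorem linearIndependent_of_JU {ρ σ : ℝ} (h : JU ρ σ) : LinearIndependent ℚ ![(1 : ℝ), ρ, σ] :=
  linearIndependent_one_of_algebraicIndependent h.2.2.2

/-- Each coordinate of a `JU` pair is irrational … -/
theorem irrational_of_JU {ρ σ : ℝ} (h : JU ρ σ) : Irrational ρ ∧ Irrational σ :=
  ⟨irrational_left_of_algebraicIndependent h.2.2.2, irrational_right_of_algebraicIndependent h.2.2.2⟩

/-- … and ultra-Liouville in the sense of g30 (`RootDecomp1BRadicalDescent02`, `UltraLiouville`). -/
theorem ultraLiouville_of_JU {ρ σ : ℝ} (h : JU ρ σ) : UltraLiouville ρ ∧ UltraLiouville σ :=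
  ⟨h.2.2.1.left (irrational_of_JU h).1, h.2.2.1.right (irrational_of_JU h).2⟩

/-- **THE STOREY-THREE TUPLE.** `(e^{ρ}, e^{σ}, ρ, σ, e, e^{i})` is algebraically independent over `ℚ` for every
pair `(ρ, σ) ∈ JU` — HYPOTHESIS-FREE (the Lindemann–Weierstrass measure `lwMeasure_holds` feeds the `DExpMeasure`
of `(e, e^{i})`). -/
theorem algebraicIndependent_six_of_JU {ρ σ : ℝ} (h : JU ρ σ) :
    AlgebraicIndependent ℚ
      (Fin.cons (cexp ((ρ : ℂ) * 1)) (Fin.cons (cexp ((σ : ℂ) * 1))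
        (Fin.cons (ρ : ℂ) (Fin.cons (σ : ℂ) (fun i => cexp (![(1 : ℂ), Complex.I] i))))) :
        Fin (2 + 4) → ℂ) :=
  algebraicIndependent_radical₂ (dExpMeasure_exp_of_LW lwMeasure_holds isAlgebraic_base linearIndependent_base) 0
    (by simp) h.2.2.1 h.2.2.2 h.1 h.2.1

/-- the six numbers lie in the polar field `F(1, ρ, σ)`. -/
theorem six_mem_polarField (ρ σ : ℝ) : ∀ i,
    (Fin.cons (cexp ((ρ : ℂ) * 1)) (Fin.cons (cexp ((σ : ℂ) * 1))
        (Fin.cons (ρ : ℂ) (Fin.cons (σ : ℂ) (fun i => cexp (![(1 : ℂ), Complex.I] i))))) :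
        Fin (2 + 4) → ℂ) i ∈ polarField ![(1 : ℝ), ρ, σ] := by
  have he : cexp 1 ∈ polarField ![(1 : ℝ), ρ, σ] := by
    simpa using exp_coe_mem_polarField ![(1 : ℝ), ρ, σ] 0
  have hei : cexp Complex.I ∈ polarField ![(1 : ℝ), ρ, σ] := by
    simpa using exp_coe_mul_I_mem_polarField ![(1 : ℝ), ρ, σ] 0
  have hρm : (ρ : ℂ) ∈ polarField ![(1 : ℝ), ρ, σ] := by
    simpa using coe_mem_polarField ![(1 : ℝ), ρ, σ] 1
  have hσm : (σ : ℂ) ∈ polarField ![(1 : ℝ), ρ, σ] := by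
    simpa using coe_mem_polarField ![(1 : ℝ), ρ, σ] 2
  have heρ : cexp (ρ : ℂ) ∈ polarField ![(1 : ℝ), ρ, σ] := by
    simpa using exp_coe_mem_polarField ![(1 : ℝ), ρ, σ] 1
  have heσ : cexp (σ : ℂ) ∈ polarField ![(1 : ℝ), ρ, σ] := by
    simpa using exp_coe_mem_polarField ![(1 : ℝ), ρ, σ] 2
  have hθmem : ∀ i, (fun i => cexp (![(1 : ℂ), Complex.I] i)) i ∈ polarField ![(1 : ℝ), ρ, σ] := by
    intro i
    fin_cases i
    · simpa using he
    · simpa using hei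
  intro i
  refine Fin.cases ?_ (fun i => ?_) i
  · simp only [Fin.cons_zero, mul_one]
    exact heρ
  · rw [Fin.cons_succ]
    refine Fin.cases ?_ (fun i => ?_) i
    · simp only [Fin.cons_zero, mul_one]
      exact heσ
    · rw [Fin.cons_succ]
      refine Fin.cases ?_ (fun i => ?_) i
      · simp only [Fin.cons_zero]
        exact hρm
      · rw [Fin.cons_succ]
        refine Fin.cases ?_ (fun j => ?_) i
        · simp only [Fin.cons_zero]
          exact hσm
        · rw [Fin.cons_succ]
          exact hθmem j

/-- **X(3)(1, ρ, σ): `t(1, ρ, σ) ≥ 6 = m + m` (`m = 3`)** for EVERY pair `(ρ, σ) ∈ JU` — hypothesis-free. -/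
theorem six_le_polarDeg_one_pair {ρ σ : ℝ} (h : JU ρ σ) :
    ((3 + 3 : ℕ) : Cardinal) ≤ polarDeg ![(1 : ℝ), ρ, σ] :=
  (Nat.cast_le.2 (by norm_num)).trans
    (natCast_le_trdeg_of_algebraicIndependent (algebraicIndependent_six_of_JU h) (six_mem_polarField ρ σ))

/-- The same in the VERBATIM shape of the body of the 1B crux `KleinPolarSchanuel` (item 24622) at `m = 3`,
`r = (1, ρ, σ)` (`polarDeg` unfolded). -/
theorem kleinPolarSchanuel_body_three_one_pair {ρ σ : ℝ} (h : JU ρ σ) :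
    ((3 + 3 : ℕ) : Cardinal) ≤ Algebra.trdeg ℚ ↥(IntermediateField.adjoin ℚ
      (Set.range (Fin.append (fun j => ((![(1 : ℝ), ρ, σ] j : ℝ) : ℂ))
          (fun j => ((![(1 : ℝ), ρ, σ] j : ℝ) : ℂ) * Complex.I)) ∪
        Set.range (Complex.exp ∘ Fin.append (fun j => ((![(1 : ℝ), ρ, σ] j : ℝ) : ℂ))
          (fun j => ((![(1 : ℝ), ρ, σ] j : ℝ) : ℂ) * Complex.I)))) :=
  six_le_polarDeg_one_pair h

/-- `t(1, ρ, σ) ≥ 6` with the numeral in the step items' shape `m + 1 + (m + 1)`, `m = 2`. -/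
theorem six_le_polarDeg_one_pair' {ρ σ : ℝ} (h : JU ρ σ) :
    ((2 + 1 + (2 + 1) : ℕ) : Cardinal) ≤ polarDeg ![(1 : ℝ), ρ, σ] :=
  (Nat.cast_le.2 (by norm_num)).trans (six_le_polarDeg_one_pair h)

/-- `t(1, ρ, σ) ≥ 5` (the weaker floor, for the SRL step instance). -/
theorem five_le_polarDeg_one_pair {ρ σ : ℝ} (h : JU ρ σ) :
    ((2 + 2 + 1 : ℕ) : Cardinal) ≤ polarDeg ![(1 : ℝ), ρ, σ] :=
  (Nat.cast_le.2 (by norm_num)).trans (six_le_polarDeg_one_pair h)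

/-- **SRLAt (1, ρ | σ)** — the sharp relative Lindemann step of item 32406 AT `(1, ρ | σ)`, `(ρ, σ) ∈ JU`. -/
theorem sharpRelativeLindemannAt_two_one_pair {ρ σ : ℝ} (h : JU ρ σ) :
    SharpRelativeLindemannAt 2 ![(1 : ℝ), ρ, σ] :=
  fun _ _ _ => five_le_polarDeg_one_pair h

/-- **T0At (1, ρ | σ)** — the tame defect-zero step of item 32407 AT `(1, ρ | σ)` (its conclusion holds outright). -/
theorem tameDefectZeroAt_two_one_pair {ρ σ : ℝ} (h : JU ρ σ) :
    TameDefectZeroAt 2 ![(1 : ℝ), ρ, σ] :=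
  fun _ _ _ _ => six_le_polarDeg_one_pair' h

/-- **W0At (1, ρ | σ)** — the wild sharp defect-zero step of item 32408 AT `(1, ρ | σ)`. -/
theorem wildSharpDefectZeroAt_two_one_pair {ρ σ : ℝ} (h : JU ρ σ) :
    WildSharpDefectZeroAt 2 ![(1 : ℝ), ρ, σ] :=
  fun _ _ _ _ _ => six_le_polarDeg_one_pair' h

/-- **W0InitAt (1, ρ | σ)** — the init-form of the wild step AT `(1, ρ | σ)`. -/
theorem wildSharpDefectZeroInitAt_two_one_pair {ρ σ : ℝ} (h : JU ρ σ) :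
    WildSharpDefectZeroInitAt 2 ![(1 : ℝ), ρ, σ] :=
  fun _ _ _ _ _ => six_le_polarDeg_one_pair' h

/-- **WSInitAt (1, ρ | σ)** — the coordinate form of the wild sharp step AT `(1, ρ | σ)`. -/
theorem wildSharpInitAt_two_one_pair {ρ σ : ℝ} (h : JU ρ σ) :
    WildSharpInitAt 2 ![(1 : ℝ), ρ, σ] :=
  fun _ _ _ _ => six_le_polarDeg_one_pair' h

/-- THE STOREYS BELOW, BY NAME (g30 cells `four_le_polarDeg_one_ultra`): `t(1, ρ) ≥ 4` … -/
theorem four_le_polarDeg_one_left {ρ σ : ℝ} (h : JU ρ σ) :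
    ((2 + 2 : ℕ) : Cardinal) ≤ polarDeg ![(1 : ℝ), ρ] :=
  four_le_polarDeg_one_ultra lwMeasure_holds (ultraLiouville_of_JU h).1

/-- … and `t(1, σ) ≥ 4`. -/
theorem four_le_polarDeg_one_right {ρ σ : ℝ} (h : JU ρ σ) :
    ((2 + 2 : ℕ) : Cardinal) ≤ polarDeg ![(1 : ℝ), σ] :=
  four_le_polarDeg_one_ultra lwMeasure_holds (ultraLiouville_of_JU h).2

/-- **FLAGSHIP.** There is a pair `(ρ, σ) ∈ JU` — so `ρ, σ > 0` are transcendental, indeed `(ρ, σ)` is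
algebraically independent and `(1, ρ, σ)` is `ℚ`-free — with `t(1, ρ, σ) ≥ 6`: the Klein-polar Schanuel inequality
decided AT a storey-three triple with TWO transcendental coordinates, hypothesis-free. -/
theorem exists_storey_three_cell :
    ∃ ρ σ : ℝ, JU ρ σ ∧ ((3 + 3 : ℕ) : Cardinal) ≤ polarDeg ![(1 : ℝ), ρ, σ] := by
  obtain ⟨ρ, σ, h⟩ := exists_pos_pair
  exact ⟨ρ, σ, h, six_le_polarDeg_one_pair h⟩

/-- … with the frame data spelled out: positivity, irrationality, `ℚ`-freeness of `(1, ρ, σ)`, algebraic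
independence of `(ρ, σ)`, the two storeys below and the storey itself. -/
theorem exists_storey_three_cell' :
    ∃ ρ σ : ℝ, 0 < ρ ∧ 0 < σ ∧ Irrational ρ ∧ Irrational σ ∧ LinearIndependent ℚ ![(1 : ℝ), ρ, σ] ∧
      AlgebraicIndependent ℚ ![(ρ : ℂ), (σ : ℂ)] ∧
      ((2 + 2 : ℕ) : Cardinal) ≤ polarDeg ![(1 : ℝ), ρ] ∧ ((2 + 2 : ℕ) : Cardinal) ≤ polarDeg ![(1 : ℝ), σ] ∧
      ((3 + 3 : ℕ) : Cardinal) ≤ polarDeg ![(1 : ℝ), ρ, σ] := by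
  obtain ⟨ρ, σ, h⟩ := exists_pos_pair
  exact ⟨ρ, σ, h.1, h.2.1, (irrational_of_JU h).1, (irrational_of_JU h).2, linearIndependent_of_JU h, h.2.2.2,
    four_le_polarDeg_one_left h, four_le_polarDeg_one_right h, six_le_polarDeg_one_pair h⟩

/-- … and such pairs are DENSE in the open quadrant (a residual, uncountable family of storey-three cells). -/
theorem dense_storey_three_cells :
    Dense {v : ℝ × ℝ | 0 < v.1 → 0 < v.2 → ((3 + 3 : ℕ) : Cardinal) ≤ polarDeg ![(1 : ℝ), v.1, v.2]} :=
  dense_setOf_JU.mono fun v (hv : 0 < v.1 → 0 < v.2 → JU v.1 v.2) h1 h2 => six_le_polarDeg_one_pair (hv h1 h2)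

end Cells

end Summit.Schanuel.Schanuel.Theorems.RootDecomp1BTwoStorey

end
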